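/- LEAD seat `ym-line-cbag-p1` (prover-ym-line-cbag-p1-g24-0), route `EguchiKawaiDirectionLadder` (ideator ym-idea-2, LINE 8),
crux K_A `TripleSmallBallMargin` (stmt-QuantumFields-27724), S10-C ingredient (LEAD's assembly contract, F4): the ONE-UNITARY
RIGIDITY TRANSFER — the within-block rigidity branch of the block-local event.  If a compression `M = Θ + R + S` (`Θ` unitary,
`R` low rank, `S` Frobenius-small) right-multiplied by a Haar block unitary `V` is entrywise rigid against a diagonal `Λ = diag(d)`
(`Σ_{ij} |d_i − d_j|² |(MV)_{ij}|² ≤ s`), then the HAAR unitary `ΘV` is rigid against `Λ` modulo a matrix of rank `≤ 2 rank R` at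
budget `2s + 8e` (`Σ|S|² ≤ e`, `|d_i| ≤ 1`); by left invariance the Haar measure of the former event is at most that of the
rank-robust rigidity event.  Index-generic (block index type `α`), companion of w4's `haar_prod_robustPairEvent_transfer`.
ROUTE-INDEPENDENT.  Nothing here bears on the Yang–Mills mass gap (barrier-ledger line onto `EguchiKawaiBreakdown`). -/
import Summits.QuantumFields.YangMills.Theorems.EguchiKawaiDirectionLadderRobustPairTransfer
import HarnessLib

/-!
# Route `EguchiKawaiDirectionLadder`, crux `TripleSmallBallMargin`: the one-unitary rigidity transfer

* `sum_norm_sq_diagonal_mul_le`, `sum_norm_sq_mul_diagonal_le` — `Σ|(ΛA)_{ij}|², Σ|(AΛ)_{ij}|² ≤ Σ|A_{ij}|²` for `Λ = diag(d)`, `|d_i| ≤ 1`;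
* `sum_norm_sq_diagonal_comm` — `Σ|(ΛW − WΛ)_{ij}|² = Σ |d_i − d_j|² |W_{ij}|²` (index-generic form of `frobSq_diagonal_comm`);
* `rigidityEvent_subset_robust` — `{V : Σ|d_i−d_j|²|((Θ+R+S)V)_{ij}|² ≤ s} ⊆ (Θ·)⁻¹{V′ : ∃R′, rank R′ ≤ 2 rank R, Σ|(ΛV′ − V′Λ − R′)_{ij}|² ≤ 2s + 8e}`;
* `haar_rigidityEvent_le_robust` — the corresponding Haar-measure inequality (left invariance by the measurable EQUIVALENCE `V ↦ ΘV`,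
  so no measurability of the robust event is needed).
-/

set_option autoImplicit false

noncomputable section

open MeasureTheory
open scoped Matrix ENNReal
open Literature.Barriers.QuantumFields

namespace Summit.QuantumFields.YangMills.Theorems.EguchiKawaiDirectionLadder

variable {α : Type} [Fintype α] [DecidableEq α]

/-- `Σ|(diag(d)·A)_{ij}|² ≤ Σ|A_{ij}|²` when `|d_i| ≤ 1`. -/
theorem sum_norm_sq_diagonal_mul_le (d : α → ℂ) (hd : ∀ i, ‖d i‖ ≤ 1) (A : Matrix α α ℂ) :
    ∑ i, ∑ j, ‖(Matrix.diagonal d * A) i j‖ ^ 2 ≤ ∑ i, ∑ j, ‖A i j‖ ^ 2 := by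
  refine Finset.sum_le_sum fun i _ => Finset.sum_le_sum fun j _ => ?_
  rw [Matrix.diagonal_mul, norm_mul, mul_pow]
  exact mul_le_of_le_one_left (sq_nonneg _) (pow_le_one₀ (norm_nonneg _) (hd i))

/-- `Σ|(A·diag(d))_{ij}|² ≤ Σ|A_{ij}|²` when `|d_j| ≤ 1`. -/
theorem sum_norm_sq_mul_diagonal_le (d : α → ℂ) (hd : ∀ i, ‖d i‖ ≤ 1) (A : Matrix α α ℂ) :
    ∑ i, ∑ j, ‖(A * Matrix.diagonal d) i j‖ ^ 2 ≤ ∑ i, ∑ j, ‖A i j‖ ^ 2 := by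
  refine Finset.sum_le_sum fun i _ => Finset.sum_le_sum fun j _ => ?_
  rw [Matrix.mul_diagonal, norm_mul, mul_pow]
  exact mul_le_of_le_one_right (sq_nonneg _) (pow_le_one₀ (norm_nonneg _) (hd j))

omit [DecidableEq α] in
/-- `Σ|(−A)_{ij}|² = Σ|A_{ij}|²`. -/
theorem sum_norm_sq_neg (A : Matrix α α ℂ) : ∑ i, ∑ j, ‖(-A) i j‖ ^ 2 = ∑ i, ∑ j, ‖A i j‖ ^ 2 := by
  simp

/-- **The commutator with a diagonal is entrywise** (index-generic): `Σ|(ΛW − WΛ)_{ij}|² = Σ |d_i − d_j|²|W_{ij}|²`. -/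
theorem sum_norm_sq_diagonal_comm (d : α → ℂ) (W : Matrix α α ℂ) :
    ∑ i, ∑ j, ‖(Matrix.diagonal d * W - W * Matrix.diagonal d) i j‖ ^ 2 = ∑ i, ∑ j, ‖d i - d j‖ ^ 2 * ‖W i j‖ ^ 2 := by
  refine Finset.sum_congr rfl fun i _ => Finset.sum_congr rfl fun j _ => ?_
  rw [Matrix.sub_apply, Matrix.diagonal_mul, Matrix.mul_diagonal, ← mul_pow, ← norm_mul]
  congr 2
  ring

/-- The commutator of a diagonal with a Frobenius-small matrix is Frobenius-small: `Σ|(ΛA − AΛ)_{ij}|² ≤ 4 Σ|A_{ij}|²` (`|d_i| ≤ 1`). -/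
theorem sum_norm_sq_diagonal_comm_le (d : α → ℂ) (hd : ∀ i, ‖d i‖ ≤ 1) (A : Matrix α α ℂ) :
    ∑ i, ∑ j, ‖(Matrix.diagonal d * A - A * Matrix.diagonal d) i j‖ ^ 2 ≤ 4 * ∑ i, ∑ j, ‖A i j‖ ^ 2 := by
  have h := sum_norm_sq_sub_le (Matrix.diagonal d * A) (A * Matrix.diagonal d)
  have h1 := sum_norm_sq_diagonal_mul_le d hd A
  have h2 := sum_norm_sq_mul_diagonal_le d hd A
  linarith

/-- **The one-unitary rigidity transfer (set inclusion).**  `M = Θ + R + S`; if `MV` is entrywise rigid against `Λ = diag(d)` at budget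
`s`, then `ΘV` is rigid against `Λ` modulo `R′ = −(Λ(RV) − (RV)Λ)` (rank `≤ 2 rank R`) at budget `2s + 8 Σ|S|²`. -/
theorem rigidityEvent_subset_robust (Θ : Matrix.unitaryGroup α ℂ) (R S : Matrix α α ℂ) (d : α → ℂ) (hd : ∀ i, ‖d i‖ ≤ 1)
    {s e : ℝ} (hS : ∑ i, ∑ j, ‖S i j‖ ^ 2 ≤ e) :
    {V : Matrix.unitaryGroup α ℂ |
        ∑ i, ∑ j, ‖d i - d j‖ ^ 2 * ‖(((Θ : Matrix α α ℂ) + R + S) * (V : Matrix α α ℂ)) i j‖ ^ 2 ≤ s} ⊆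
      (fun V => Θ * V) ⁻¹'
        {V' : Matrix.unitaryGroup α ℂ | ∃ R' : Matrix α α ℂ, R'.rank ≤ 2 * R.rank ∧
          ∑ i, ∑ j, ‖(Matrix.diagonal d * (V' : Matrix α α ℂ) - (V' : Matrix α α ℂ) * Matrix.diagonal d - R') i j‖ ^ 2 ≤
            2 * s + 8 * e} := by
  intro V hV
  simp only [Set.mem_setOf_eq] at hV
  simp only [Set.mem_preimage, Set.mem_setOf_eq, Matrix.UnitaryGroup.mul_val]
  set Λ : Matrix α α ℂ := Matrix.diagonal d with hΛ
  set RV : Matrix α α ℂ := R * (V : Matrix α α ℂ) with hRV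
  set SV : Matrix α α ℂ := S * (V : Matrix α α ℂ) with hSV
  set ΘV : Matrix α α ℂ := (Θ : Matrix α α ℂ) * (V : Matrix α α ℂ) with hΘV
  refine ⟨-(Λ * RV - RV * Λ), ?_, ?_⟩
  · -- rank
    rw [rank_neg]
    calc (Λ * RV - RV * Λ).rank ≤ (Λ * RV).rank + (RV * Λ).rank := rank_sub_le _ _
      _ ≤ R.rank + R.rank := by
          refine add_le_add ?_ ?_
          · exact (Matrix.rank_mul_le_right _ _).trans (Matrix.rank_mul_le_left _ _)
          · exact (Matrix.rank_mul_le_left _ _).trans (Matrix.rank_mul_le_left _ _)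
      _ = 2 * R.rank := by ring
  · -- Frobenius: `[Λ,ΘV] + [Λ,RV] = [Λ, MV] − [Λ, SV]`
    have hMV : ((Θ : Matrix α α ℂ) + R + S) * (V : Matrix α α ℂ) = ΘV + RV + SV := by
      rw [hΘV, hRV, hSV]; noncomm_ring
    have hid : Λ * ΘV - ΘV * Λ - -(Λ * RV - RV * Λ) =
        (Λ * (ΘV + RV + SV) - (ΘV + RV + SV) * Λ) - (Λ * SV - SV * Λ) := by noncomm_ring
    rw [hid]
    have h1 := sum_norm_sq_sub_le (Λ * (ΘV + RV + SV) - (ΘV + RV + SV) * Λ) (Λ * SV - SV * Λ)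
    have h2 : ∑ i, ∑ j, ‖(Λ * (ΘV + RV + SV) - (ΘV + RV + SV) * Λ) i j‖ ^ 2 ≤ s := by
      rw [hΛ, sum_norm_sq_diagonal_comm, ← hMV]; exact hV
    have h3 : ∑ i, ∑ j, ‖(Λ * SV - SV * Λ) i j‖ ^ 2 ≤ 4 * e := by
      have h := sum_norm_sq_diagonal_comm_le d hd SV
      have hSV' : ∑ i, ∑ j, ‖SV i j‖ ^ 2 ≤ e := by rw [hSV, sum_norm_sq_mul_unitary]; exact hS
      rw [hΛ]; linarith
    linarith

/-- **The one-unitary rigidity transfer (Haar measures).** -/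
theorem haar_rigidityEvent_le_robust (Θ : Matrix.unitaryGroup α ℂ) (R S : Matrix α α ℂ) (d : α → ℂ) (hd : ∀ i, ‖d i‖ ≤ 1)
    {q : ℕ} {s e : ℝ} (hR : R.rank ≤ q) (hS : ∑ i, ∑ j, ‖S i j‖ ^ 2 ≤ e) :
    Literature.MathematicalPhysics.QuantumFieldTheory.haarProbability (Matrix.unitaryGroup α ℂ)
        {V : Matrix.unitaryGroup α ℂ |
          ∑ i, ∑ j, ‖d i - d j‖ ^ 2 * ‖(((Θ : Matrix α α ℂ) + R + S) * (V : Matrix α α ℂ)) i j‖ ^ 2 ≤ s} ≤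
      Literature.MathematicalPhysics.QuantumFieldTheory.haarProbability (Matrix.unitaryGroup α ℂ)
        {V' : Matrix.unitaryGroup α ℂ | ∃ R' : Matrix α α ℂ, R'.rank ≤ 2 * q ∧
          ∑ i, ∑ j, ‖(Matrix.diagonal d * (V' : Matrix α α ℂ) - (V' : Matrix α α ℂ) * Matrix.diagonal d - R') i j‖ ^ 2 ≤
            2 * s + 8 * e} := by
  set μ := Literature.MathematicalPhysics.QuantumFieldTheory.haarProbability (Matrix.unitaryGroup α ℂ) with hμ
  have hsub := rigidityEvent_subset_robust Θ R S d hd (s := s) hS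
  have hmono : {V' : Matrix.unitaryGroup α ℂ | ∃ R' : Matrix α α ℂ, R'.rank ≤ 2 * R.rank ∧
      ∑ i, ∑ j, ‖(Matrix.diagonal d * (V' : Matrix α α ℂ) - (V' : Matrix α α ℂ) * Matrix.diagonal d - R') i j‖ ^ 2 ≤
        2 * s + 8 * e} ⊆
      {V' : Matrix.unitaryGroup α ℂ | ∃ R' : Matrix α α ℂ, R'.rank ≤ 2 * q ∧
      ∑ i, ∑ j, ‖(Matrix.diagonal d * (V' : Matrix α α ℂ) - (V' : Matrix α α ℂ) * Matrix.diagonal d - R') i j‖ ^ 2 ≤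
        2 * s + 8 * e} := by
    rintro V' ⟨R', hR', h⟩
    exact ⟨R', hR'.trans (Nat.mul_le_mul_left 2 hR), h⟩
  have hmp : MeasurePreserving (MeasurableEquiv.mulLeft Θ) μ μ := measurePreserving_mul_left μ Θ
  calc μ {V : Matrix.unitaryGroup α ℂ |
          ∑ i, ∑ j, ‖d i - d j‖ ^ 2 * ‖(((Θ : Matrix α α ℂ) + R + S) * (V : Matrix α α ℂ)) i j‖ ^ 2 ≤ s}
      ≤ μ ((MeasurableEquiv.mulLeft Θ) ⁻¹' {V' : Matrix.unitaryGroup α ℂ | ∃ R' : Matrix α α ℂ, R'.rank ≤ 2 * q ∧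
          ∑ i, ∑ j, ‖(Matrix.diagonal d * (V' : Matrix α α ℂ) - (V' : Matrix α α ℂ) * Matrix.diagonal d - R') i j‖ ^ 2 ≤
            2 * s + 8 * e}) := measure_mono (hsub.trans (Set.preimage_mono hmono))
    _ = _ := hmp.measure_preimage_equiv _

end Summit.QuantumFields.YangMills.Theorems.EguchiKawaiDirectionLadder

end
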